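import Literature.AlgebraicGeometry.HodgeTheory.HypersurfaceResidueFormulaLocal
import Literature.NumberTheory.Transcendental.ComplexFormsPullback
import HarnessLib

/-!
# Relative Griffiths residue forms on the total space of a family of hypersurfaces

Family `hodge`, layer `Literature/AlgebraicGeometry/HodgeTheory`. PROOF FILE (theorems only; no
definition, no named fact), companion of `HypersurfaceResidueFormDef` /
`HypersurfaceResidueFormulaLocal` / `HypersurfaceResidueFormHolomorphic`. Written by the prover seat
`hodge-nonav-prover-Ax` (g12, cell `hodge-nonav`) as brick F-B of the programme «GRIFFITHS-SURFACES /
B4 RELATIVE RESIDUES» (route `HodgeConjecture/CyclicUnitaryPowers`): the holomorphic variation of the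
Griffiths residues `Res(PΩ/F_b)` of a family of smooth hypersurfaces `{F_b = 0} ⊂ ℙ^{m+1}` is read
through `m`-forms on the TOTAL SPACE of the family whose restrictions to the fibres are the residue
forms (Griffiths 1969, §8: "the periods of the residues vary holomorphically"; Voisin II §6.1).

Let `T` be a complex manifold charted on `E` and `ψ : T → ℙ ℂ ℂ^{m+2}` a map with holomorphic affine
coordinates (for the total space `𝒴` of a family of hypersurfaces: the projection to `ℙ^{m+1}`), and
let the equation of the fibre through `y ∈ T` be `F_y = Σ_s c_s(y) • G_s` for finitely many fixed
polynomials `G_s` and HOLOMORPHIC coefficient functions `c_s : T → ℂ` (for the universal hypersurface: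
`G_m = x^m`, `c_m =` the coefficient `a_m`, a regular function on the total space). The tree's
fixed-index residue formula `residueFormula ψ F P i j y = P(Z̃ᵢ y) · det(N_j(F, Z̃ᵢ y), Z̃ᵢ y, dZ̃ᵢ(y) ·)`
makes sense on ANY manifold mapping to `ℙ`, in particular on `T` with the varying equation `F_y`:

* `residueFormula_eq_smul_residueFormula_X` — **the equation enters only through a scalar**:
  `residueFormula ψ F P i j y = (P(Z̃ᵢ y) / ∂_jF(Z̃ᵢ y)) • residueFormula ψ (X j) 1 i j y`, the kernel
  `det(e_j, Z̃ᵢ y, dZ̃ᵢ(y) ·)` being INDEPENDENT of `F` (`N_j(F, z) = (∂_jF z)⁻¹ e_j`, `coneResidue_smul_left`);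
* `exists_analyticGerm_residueFormula_family` — hence **the relative residue form
  `y ↦ residueFormula ψ F_y P i j y` is holomorphic in charts** at every `y₀ ∈ Tᵢ = ψ⁻¹(Uᵢ)` with
  `∂_jF_{y₀}(Z̃ᵢ y₀) ≠ 0` (the kernel is, by the tree's `exists_analyticGerm_residueFormula` "for ANY
  degree of `F`"; the scalar is a quotient of holomorphic functions read in the chart, analytic by
  Osgood, `SCV.analyticAt_of_differentiableOn`); stated for any form agreeing with it NEAR `y₀`, so
  that cut-off / glued forms qualify; `isOpen_setOf_eval_pderiv_ne_zero` — admissibility of `(i, j)`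
  is an open condition on `T`;
* `liftDeriv_comp`, `pullback_residueFormula` — **restriction to a fibre**: for a holomorphic map
  `ι : X → T` of complex manifolds, `dZ̃ᵢ(ι x) ∘ dι_x = d(Z̃ᵢ ∘ ι)_x` and the pull-back of the relative
  residue form along `ι` is the residue formula of `ψ ∘ ι` with the equation `F_{ι x}`
  (`coneResidue_comp'`; the real differential of `ι` is its complex one, `mfderiv_real_eq_restrictScalars`).
  On a fibre `X_b` (where `F_{ι x} = F_b` is constant) this is `residueFormula (ψ ∘ ι) F_b P i j`, which is
  the residue form `Res(PΩ/F_b)` of the fibre near every admissible point (`residueForm_eventuallyEq`).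

These are the inputs «local holomorphic relative forms with equal fibre restrictions» of the
partition-of-unity gluing (brick F-A) feeding the holomorphy of period integrals
(`PeriodIntegralHolomorphicVertical`, brick B1).

## References

* [Griffiths1969] P. Griffiths, On the periods of certain rational integrals I, Ann. of Math. 90
  (1969), §8.
* [VoisinHodgeII2003] C. Voisin, Hodge Theory and Complex Algebraic Geometry II (2003), §6.1.1, §6.1.3.
* [VoisinHodgeI2002] C. Voisin, Hodge Theory and Complex Algebraic Geometry I (2002), §9.1.1, §10.2.2.
-/

noncomputable section

open scoped Manifold ContDiff Topology LinearAlgebra.Projectivization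
open Set Filter Projectivization

namespace Literature.AlgebraicGeometry.HodgeTheory

open Literature.NumberTheory.Transcendental Literature.Geometry.Kaehler

-- The identification `TangentSpace I x = E` is an abuse of definitional equality; as in the tree's
-- form files we let `isDefEq` unfold it.
set_option backward.isDefEq.respectTransparency false

/-! ### The equation enters the residue formula only through a scalar -/

section Algebra

variable {m : ℕ} {E : Type*} [NormedAddCommGroup E] [NormedSpace ℂ E]
  {M : Type*} [TopologicalSpace M] [ChartedSpace E M]
  (ψ : M → ℙ ℂ (Fin (m + 2) → ℂ))

/-- The normal vector of the coordinate hyperplane `X_j` is the basis vector `e_j`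
(`∂_j X_j = 1`); the local generator `± dx_K/(∂f/∂x_j)` of Voisin II §6.1.3 for `f = x_j`.
[cite: VoisinHodgeII2003, §6.1.3] -/
theorem normalVec_X_self (z : Fin (m + 2) → ℂ) (j : Fin (m + 2)) :
    normalVec (MvPolynomial.X j) z j = Pi.single j 1 := by
  rw [normalVec, MvPolynomial.pderiv_X_self, map_one, inv_one, one_smul]

/-- `N_j(F, z) = (∂_jF(z))⁻¹ • N_j(X_j, z)`: the normal vector of `F` is a scalar multiple of the
`F`-independent vector `e_j` (Voisin II §6.1.3: `Res_{Uᵢ}(Ω/F) = ± dx_K/(∂F/∂x_j)`).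
[cite: VoisinHodgeII2003, §6.1.3] -/
theorem normalVec_eq_smul_normalVec_X (F : MvPolynomial (Fin (m + 2)) ℂ) (z : Fin (m + 2) → ℂ)
    (j : Fin (m + 2)) :
    normalVec F z j =
      (MvPolynomial.eval z (MvPolynomial.pderiv j F))⁻¹ • normalVec (MvPolynomial.X j) z j := by
  rw [normalVec_X_self, normalVec]

/-- **The equation enters the residue formula only through a scalar factor**:
`residueFormula ψ F P i j y = (P(Z̃ᵢ y) · (∂_jF(Z̃ᵢ y))⁻¹) • residueFormula ψ (X j) 1 i j y`, where
the kernel `residueFormula ψ (X j) 1 i j y = det(e_j, Z̃ᵢ y, dZ̃ᵢ(y) ·)` does not involve `F` (in print: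
`Res_{Uᵢ}(PΩ/F) = (P/(∂F/∂x_j)) · (± dx_K)`, Voisin II §6.1.3). [cite: VoisinHodgeII2003, §6.1.3] -/
theorem residueFormula_eq_smul_residueFormula_X (F P : MvPolynomial (Fin (m + 2)) ℂ)
    (i j : Fin (m + 2)) (y : M) :
    residueFormula (E := E) ψ F P i j y =
      (MvPolynomial.eval (projLift ψ i y) P *
          (MvPolynomial.eval (projLift ψ i y) (MvPolynomial.pderiv j F))⁻¹) •
        residueFormula ψ (MvPolynomial.X j) 1 i j y := by
  rw [residueFormula, residueFormula, normalVec_eq_smul_normalVec_X F, coneResidue_smul_left, map_one,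
    one_smul, smul_smul]

/-- The partial derivative of the equation `F_y = Σ_s c_s(y) • G_s` of a family, evaluated:
`∂_jF_y(z) = Σ_s c_s(y) · ∂_jG_s(z)` (the universal hypersurface `F = Σ a_m x^m`, Voisin II §6.2.1).
[cite: VoisinHodgeII2003, §6.2.1] -/
theorem eval_pderiv_sum_smul {σ : Type*} [Fintype σ] (G : σ → MvPolynomial (Fin (m + 2)) ℂ)
    (c : σ → ℂ) (z : Fin (m + 2) → ℂ) (j : Fin (m + 2)) :
    MvPolynomial.eval z (MvPolynomial.pderiv j (∑ s, c s • G s)) =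
      ∑ s, c s * MvPolynomial.eval z (MvPolynomial.pderiv j (G s)) := by
  rw [map_sum, map_sum]
  refine Finset.sum_congr rfl fun s _ ↦ ?_
  rw [(MvPolynomial.pderiv j).map_smul, MvPolynomial.smul_eval]

end Algebra

/-! ### Holomorphy in charts of the relative residue form -/

section Holomorphy

variable {m : ℕ} {E : Type*} [NormedAddCommGroup E] [NormedSpace ℂ E] [FiniteDimensional ℂ E]
  {M : Type*} [TopologicalSpace M] [ChartedSpace E M] [IsManifold 𝓘(ℂ, E) ω M]
  (ψ : M → ℙ ℂ (Fin (m + 2) → ℂ))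

/-- A holomorphic function read in the chart at `x₀` is analytic at every point of the chart target
(`ℂ`-differentiable on the open target, hence analytic by Osgood's lemma in several variables,
`Literature.Analysis.Complex.SCV.analyticAt_of_differentiableOn`). [cite: FritzscheGrauert2002, Ch. I §8 Thm. 8.5] -/
theorem analyticAt_comp_extChartAt_symm_of_mdifferentiable {c : M → ℂ}
    (hc : MDifferentiable 𝓘(ℂ, E) 𝓘(ℂ, ℂ) c) (x₀ : M) {y : E}
    (hy : y ∈ (extChartAt 𝓘(ℂ, E) x₀).target) :
    AnalyticAt ℂ (c ∘ (extChartAt 𝓘(ℂ, E) x₀).symm) y := by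
  refine Literature.Analysis.Complex.SCV.analyticAt_of_differentiableOn ?_
    (isOpen_extChartAt_target x₀) hy
  intro y' hy'
  have h2 : MDifferentiableWithinAt 𝓘(ℂ, E) 𝓘(ℂ, E) (extChartAt 𝓘(ℂ, E) x₀).symm (range 𝓘(ℂ, E)) y' :=
    mdifferentiableWithinAt_extChartAt_symm hy'
  have h3 := (hc _).comp_mdifferentiableWithinAt y' h2
  rw [ModelWithCorners.Boundaryless.range_eq_univ, mdifferentiableWithinAt_univ,
    mdifferentiableAt_iff_differentiableAt] at h3
  exact h3.differentiableWithinAt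

omit [FiniteDimensional ℂ E] [IsManifold 𝓘(ℂ, E) ω M] in
/-- **Admissibility of the indices is an open condition**: for holomorphic coefficients `c_s` and
`ψ` continuous with holomorphic affine coordinates, `{y ∈ Tᵢ | ∂_jF_y(Z̃ᵢ y) ≠ 0}` is open
(`F_y = Σ_s c_s(y) • G_s`; the Euler charts `D₊(xᵢ ∂ⱼF)` of the universal hypersurface, Voisin II
§6.2.1). [cite: VoisinHodgeII2003, §6.2.1] -/
theorem isOpen_setOf_eval_pderiv_ne_zero (hψ : Continuous ψ) (hhol : HasHolomorphicCoords E ψ)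
    {σ : Type*} [Fintype σ] (G : σ → MvPolynomial (Fin (m + 2)) ℂ) {c : σ → M → ℂ}
    (hc : ∀ s, MDifferentiable 𝓘(ℂ, E) 𝓘(ℂ, ℂ) (c s)) (i j : Fin (m + 2)) :
    IsOpen {y ∈ liftDomain ψ i |
      MvPolynomial.eval (projLift ψ i y) (MvPolynomial.pderiv j (∑ s, c s y • G s)) ≠ 0} := by
  have hcont : ContinuousOn
      (fun y ↦ MvPolynomial.eval (projLift ψ i y) (MvPolynomial.pderiv j (∑ s, c s y • G s)))
      (liftDomain ψ i) := by
    have h1 : ContinuousOn (projLift ψ i) (liftDomain ψ i) :=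
      (mdifferentiableOn_projLift ψ hhol i).continuousOn
    have h2 : ∀ s, Continuous (c s) := fun s ↦ (hc s).continuous
    simp_rw [eval_pderiv_sum_smul]
    refine continuousOn_finsetSum _ fun s _ ↦ ((h2 s).continuousOn).mul ?_
    exact (MvPolynomial.continuous_eval _).comp_continuousOn h1
  exact hcont.isOpen_inter_preimage (isOpen_liftDomain ψ hψ i) isOpen_ne

/-- **The relative residue form is holomorphic in charts.** Let `ψ : T → ℙ ℂ ℂ^{m+2}` be continuous
with holomorphic affine coordinates, `F_y = Σ_s c_s(y) • G_s` with holomorphic `c_s : T → ℂ`, `P` any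
polynomial, `i` a chart index with `y₀ ∈ Tᵢ` and `j` a normal index with `∂_jF_{y₀}(Z̃ᵢ y₀) ≠ 0`. Then
every `m`-form `η` on `T` which, NEAR `y₀`, is `y ↦ residueFormula ψ F_y P i j y` (real scalars
restricted) has, in the chart at `y₀`, a complex-analytic representative: the germ of
`y ↦ (P(Z y)/∂_jF_{y}(Z y)) • det(e_j, Z y, DZ(y) ·)`, `Z = Z̃ᵢ ∘ chart⁻¹` — the analytic germ of the
`F`-independent kernel (`exists_analyticGerm_residueFormula` for the equation `X_j`) times an analytic
scalar. (Griffiths 1969 §8: in the local coordinates of the total space the residue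
`P dx_K/(∂F/∂x_j)` depends holomorphically on the parameters.) [cite: Griffiths1969, §8]
[cite: VoisinHodgeII2003, §6.1.3] -/
theorem exists_analyticGerm_residueFormula_family [IsManifold 𝓘(ℝ, E) ∞ M] (hψ : Continuous ψ)
    (hhol : HasHolomorphicCoords E ψ) {σ : Type*} [Fintype σ] (G : σ → MvPolynomial (Fin (m + 2)) ℂ)
    {c : σ → M → ℂ} (hc : ∀ s, MDifferentiable 𝓘(ℂ, E) 𝓘(ℂ, ℂ) (c s))
    (P : MvPolynomial (Fin (m + 2)) ℂ) {i j : Fin (m + 2)} {y₀ : M} (hi : y₀ ∈ liftDomain ψ i)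
    (hj : MvPolynomial.eval (projLift ψ i y₀) (MvPolynomial.pderiv j (∑ s, c s y₀ • G s)) ≠ 0)
    {η : MForm 𝓘(ℝ, E) M ℂ m}
    (hη : ∀ᶠ y in 𝓝 y₀, η y = (show E [⋀^Fin m]→L[ℝ] ℂ from
      (residueFormula ψ (∑ s, c s y • G s) P i j y).restrictScalars ℝ)) :
    ∃ g : E → E [⋀^Fin m]→L[ℂ] ℂ, AnalyticAt ℂ g (extChartAt 𝓘(ℝ, E) y₀ y₀) ∧
      η.inChart y₀ =ᶠ[𝓝 (extChartAt 𝓘(ℝ, E) y₀ y₀)] fun y ↦ (g y).restrictScalars ℝ := by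
  -- the `F`-independent kernel `K y = det(e_j, Z̃ᵢ y, dZ̃ᵢ(y) ·)` and its analytic germ
  set K : MForm 𝓘(ℝ, E) M ℂ m := fun y ↦
    show E [⋀^Fin m]→L[ℝ] ℂ from (residueFormula ψ (MvPolynomial.X j) 1 i j y).restrictScalars ℝ
    with hKdef
  have hjX : MvPolynomial.eval (projLift ψ i y₀) (MvPolynomial.pderiv j
      (MvPolynomial.X j : MvPolynomial (Fin (m + 2)) ℂ)) ≠ 0 := by
    rw [MvPolynomial.pderiv_X_self, map_one]; exact one_ne_zero
  obtain ⟨gK, hgK, hKg⟩ := exists_analyticGerm_residueFormula ψ hψ hhol 1 hi hjX (η₀ := K)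
    (fun _ ↦ rfl)
  -- the scalar factor `h y = P(Z̃ᵢ y) · (∂_jF_y(Z̃ᵢ y))⁻¹`, read in the chart
  have hc₀ : extChartAt 𝓘(ℝ, E) y₀ y₀ = extChartAt 𝓘(ℂ, E) y₀ y₀ := rfl
  set Zc : E → Fin (m + 2) → ℂ := projLift ψ i ∘ (extChartAt 𝓘(ℂ, E) y₀).symm with hZc
  set hsc : E → ℂ := fun z ↦ MvPolynomial.eval (Zc z) P *
    (∑ s, c s ((extChartAt 𝓘(ℂ, E) y₀).symm z) *
      MvPolynomial.eval (Zc z) (MvPolynomial.pderiv j (G s)))⁻¹ with hhsc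
  have hZc₀ : Zc (extChartAt 𝓘(ℂ, E) y₀ y₀) = projLift ψ i y₀ := by simp [hZc]
  have hZ : AnalyticAt ℂ Zc (extChartAt 𝓘(ℂ, E) y₀ y₀) :=
    analyticAt_projLift_comp_symm ψ hψ hhol i y₀ (mem_extChartAt_target y₀) (by simpa using hi)
  have hscal : AnalyticAt ℂ hsc (extChartAt 𝓘(ℂ, E) y₀ y₀) := by
    have hPz : AnalyticAt ℂ (fun z ↦ MvPolynomial.eval (Zc z) P) (extChartAt 𝓘(ℂ, E) y₀ y₀) :=
      (AnalyticOnNhd.eval_mvPolynomial P _ (mem_univ _)).comp hZ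
    have hsum : AnalyticAt ℂ (fun z ↦ ∑ s, c s ((extChartAt 𝓘(ℂ, E) y₀).symm z) *
        MvPolynomial.eval (Zc z) (MvPolynomial.pderiv j (G s))) (extChartAt 𝓘(ℂ, E) y₀ y₀) := by
      refine Finset.analyticAt_fun_sum Finset.univ fun s _ ↦ ?_
      exact (analyticAt_comp_extChartAt_symm_of_mdifferentiable (hc s) y₀
        (mem_extChartAt_target y₀)).mul
        ((AnalyticOnNhd.eval_mvPolynomial (MvPolynomial.pderiv j (G s)) _ (mem_univ _)).comp hZ)
    have hne : (∑ s, c s ((extChartAt 𝓘(ℂ, E) y₀).symm (extChartAt 𝓘(ℂ, E) y₀ y₀)) *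
        MvPolynomial.eval (Zc (extChartAt 𝓘(ℂ, E) y₀ y₀)) (MvPolynomial.pderiv j (G s))) ≠ 0 := by
      rw [hZc₀, extChartAt_to_inv, ← eval_pderiv_sum_smul]
      exact hj
    exact hPz.mul (hsum.inv hne)
  refine ⟨fun z ↦ (hsc z • gK z : E [⋀^Fin m]→L[ℂ] ℂ), ?_, ?_⟩
  · rw [hc₀]
    exact hscal.smul (hc₀ ▸ hgK)
  · -- the chart representative of `η` is the scalar times that of `K`
    have htarget : ∀ᶠ z in 𝓝 (extChartAt 𝓘(ℂ, E) y₀ y₀), z ∈ (extChartAt 𝓘(ℂ, E) y₀).target :=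
      extChartAt_target_mem_nhds y₀
    have hsymm : ContinuousAt (extChartAt 𝓘(ℂ, E) y₀).symm (extChartAt 𝓘(ℂ, E) y₀ y₀) :=
      continuousAt_extChartAt_symm y₀
    have hη' : ∀ᶠ y in 𝓝 ((extChartAt 𝓘(ℂ, E) y₀).symm (extChartAt 𝓘(ℂ, E) y₀ y₀)),
        η y = (show E [⋀^Fin m]→L[ℝ] ℂ from
          (residueFormula ψ (∑ s, c s y • G s) P i j y).restrictScalars ℝ) := by
      rw [extChartAt_to_inv]; exact hη
    have hdom := hsymm.tendsto.eventually hη'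
    rw [hc₀] at hKg ⊢
    filter_upwards [htarget, hdom, hKg] with z hz hzη hzK
    set y := (extChartAt 𝓘(ℂ, E) y₀).symm z with hy
    rw [MForm.inChart_eq_of_mem_target _ hz]
    rw [MForm.inChart_eq_of_mem_target _ hz] at hzK
    change (η y).compContinuousLinearMap (tangentCoordChange 𝓘(ℝ, E) y₀ y y) =
      (hsc z • gK z).restrictScalars ℝ
    rw [hzη]
    change ((residueFormula ψ (∑ s, c s y • G s) P i j y).restrictScalars ℝ).compContinuousLinearMap
      (tangentCoordChange 𝓘(ℝ, E) y₀ y y) = (hsc z • gK z).restrictScalars ℝ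
    change ((residueFormula ψ (MvPolynomial.X j) 1 i j y).restrictScalars ℝ).compContinuousLinearMap
      (tangentCoordChange 𝓘(ℝ, E) y₀ y y) = (gK z).restrictScalars ℝ at hzK
    rw [residueFormula_eq_smul_residueFormula_X, eval_pderiv_sum_smul]
    have hscz : MvPolynomial.eval (projLift ψ i y) P *
        (∑ s, c s y * MvPolynomial.eval (projLift ψ i y) (MvPolynomial.pderiv j (G s)))⁻¹ = hsc z := by
      simp [hhsc, hZc, hy]
    rw [hscz]
    ext v
    have := congrArg (fun A : E [⋀^Fin m]→L[ℝ] ℂ ↦ A v) hzK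
    simp only [ContinuousAlternatingMap.compContinuousLinearMap_apply,
      ContinuousAlternatingMap.coe_restrictScalars, ContinuousAlternatingMap.smul_apply] at this ⊢
    rw [this]

end Holomorphy

/-! ### Restriction to a fibre: pull-back of the relative residue form along a holomorphic map -/

section Pullback

variable {m : ℕ} {E : Type*} [NormedAddCommGroup E] [NormedSpace ℂ E]
  {M : Type*} [TopologicalSpace M] [ChartedSpace E M]
  {EX : Type*} [NormedAddCommGroup EX] [NormedSpace ℂ EX]
  {X : Type*} [TopologicalSpace X] [ChartedSpace EX X]
  (ψ : M → ℙ ℂ (Fin (m + 2) → ℂ)) (ι : X → M)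

omit [TopologicalSpace M] [ChartedSpace E M] [TopologicalSpace X] [ChartedSpace EX X] in
/-- The lift of `ψ ∘ ι` is the lift of `ψ` composed with `ι` (definitional; the affine coordinates of
the standard charts of `ℙ`, Voisin II §6.1.3). [cite: VoisinHodgeII2003, §6.1.3] -/
theorem projLift_comp (i : Fin (m + 2)) : projLift (ψ ∘ ι) i = projLift ψ i ∘ ι := rfl

omit [TopologicalSpace M] [ChartedSpace E M] [TopologicalSpace X] [ChartedSpace EX X] in
/-- The chart domain of `ψ ∘ ι` is the preimage of that of `ψ` (definitional; Voisin II §6.1.3).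
[cite: VoisinHodgeII2003, §6.1.3] -/
theorem liftDomain_comp (i : Fin (m + 2)) : liftDomain (ψ ∘ ι) i = ι ⁻¹' liftDomain ψ i := rfl

/-- Pulling back the lift differential along a linear map between DIFFERENT model spaces pulls back
the cone residue form (the tree's `coneResidue_comp` is the endomorphism case; naturality of
`Res(PΩ/F)`, Voisin II §6.1.1). [cite: VoisinHodgeII2003, §6.1.1] -/
theorem coneResidue_comp' (N z : Fin (m + 2) → ℂ) (L : E →L[ℂ] (Fin (m + 2) → ℂ)) (D : EX →L[ℂ] E) :
    coneResidue N z (L.comp D) = (coneResidue N z L).compContinuousLinearMap D := by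
  ext v
  simp [coneResidue_apply]

/-- **Chain rule for the lift**: `d(Z̃ᵢ ∘ ι)_x = dZ̃ᵢ(ι x) ∘ dι_x` for `ι` holomorphic at `x` and
`ι x ∈ Tᵢ` (where `Z̃ᵢ` is holomorphic, `mdifferentiableOn_projLift`; Voisin I §2.2.1).
[cite: VoisinHodgeI2002, §2.2.1] -/
theorem liftDeriv_comp (hψ : Continuous ψ) (hhol : HasHolomorphicCoords E ψ) {i : Fin (m + 2)} {x : X}
    (hι : MDifferentiableAt 𝓘(ℂ, EX) 𝓘(ℂ, E) ι x) (hx : ι x ∈ liftDomain ψ i) :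
    liftDeriv (ψ ∘ ι) i x =
      (liftDeriv ψ i (ι x)).comp (show EX →L[ℂ] E from mfderiv 𝓘(ℂ, EX) 𝓘(ℂ, E) ι x) := by
  have hZ : MDifferentiableAt 𝓘(ℂ, E) 𝓘(ℂ, Fin (m + 2) → ℂ) (projLift ψ i) (ι x) :=
    (mdifferentiableOn_projLift ψ hhol i _ hx).mdifferentiableAt ((isOpen_liftDomain ψ hψ i).mem_nhds hx)
  refine ContinuousLinearMap.ext fun v ↦ ?_
  change liftDeriv (ψ ∘ ι) i x v =
    liftDeriv ψ i (ι x) (show E from mfderiv 𝓘(ℂ, EX) 𝓘(ℂ, E) ι x v)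
  rw [liftDeriv_apply, liftDeriv_apply, projLift_comp, mfderiv_comp x hZ hι]
  rfl

/-- **Pull-back of the relative residue form along a holomorphic map is the residue formula of the
composite**: for `ι : X → T` holomorphic at `x` with `ι x ∈ Tᵢ`, and any equation `F` and numerator
`P`, the real pull-back `ι^*` of the form `y ↦ residueFormula ψ F P i j y` at `x` is
`residueFormula (ψ ∘ ι) F P i j x` (the real differential of `ι` is the complex one,
`mfderiv_real_eq_restrictScalars`; `liftDeriv_comp`, `coneResidue_comp'`). Applied on a fibre `X_b` of a
family, where the equation `F = F_b` is constant, this says that the relative residue form RESTRICTS to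
the residue formula of the fibre, i.e. (near admissible points, `residueForm_eventuallyEq`) to
`Res(PΩ/F_b)`. [cite: VoisinHodgeII2003, §6.1.1 and §6.1.3] [cite: Griffiths1969, §8] -/
theorem pullback_residueFormula_apply (hψ : Continuous ψ) (hhol : HasHolomorphicCoords E ψ)
    (F P : MvPolynomial (Fin (m + 2)) ℂ) {i : Fin (m + 2)} (j : Fin (m + 2)) {x : X}
    (hι : MDifferentiableAt 𝓘(ℂ, EX) 𝓘(ℂ, E) ι x) (hx : ι x ∈ liftDomain ψ i)
    {η : MForm 𝓘(ℝ, E) M ℂ m}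
    (hη : η (ι x) = (show E [⋀^Fin m]→L[ℝ] ℂ from (residueFormula ψ F P i j (ι x)).restrictScalars ℝ)) :
    η.pullback 𝓘(ℝ, EX) ι x =
      (show EX [⋀^Fin m]→L[ℝ] ℂ from (residueFormula (ψ ∘ ι) F P i j x).restrictScalars ℝ) := by
  ext v
  rw [MForm.pullback_apply, hη, mfderiv_real_eq_restrictScalars hι]
  change residueFormula ψ F P i j (ι x)
      (fun k ↦ (show EX →L[ℂ] E from mfderiv 𝓘(ℂ, EX) 𝓘(ℂ, E) ι x) (show EX from v k)) =
    residueFormula (ψ ∘ ι) F P i j x (fun k ↦ (show EX from v k))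
  rw [residueFormula, residueFormula, liftDeriv_comp ψ ι hψ hhol hι hx, coneResidue_comp']
  rfl

/-- The same for the RELATIVE form of a family `F_y = Σ_s c_s(y) • G_s`: its pull-back along `ι` at
`x` is the residue formula of `ψ ∘ ι` for the equation `F_{ι x}` of the fibre through `ι x`.
[cite: VoisinHodgeII2003, §6.1.3] [cite: Griffiths1969, §8] -/
theorem pullback_residueFormula_family_apply (hψ : Continuous ψ) (hhol : HasHolomorphicCoords E ψ)
    {σ : Type*} [Fintype σ] (G : σ → MvPolynomial (Fin (m + 2)) ℂ) (c : σ → M → ℂ)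
    (P : MvPolynomial (Fin (m + 2)) ℂ) {i : Fin (m + 2)} (j : Fin (m + 2)) {x : X}
    (hι : MDifferentiableAt 𝓘(ℂ, EX) 𝓘(ℂ, E) ι x) (hx : ι x ∈ liftDomain ψ i)
    {η : MForm 𝓘(ℝ, E) M ℂ m}
    (hη : η (ι x) = (show E [⋀^Fin m]→L[ℝ] ℂ from
      (residueFormula ψ (∑ s, c s (ι x) • G s) P i j (ι x)).restrictScalars ℝ)) :
    η.pullback 𝓘(ℝ, EX) ι x =
      (show EX [⋀^Fin m]→L[ℝ] ℂ from
        (residueFormula (ψ ∘ ι) (∑ s, c s (ι x) • G s) P i j x).restrictScalars ℝ) :=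
  pullback_residueFormula_apply ψ ι hψ hhol _ P j hι hx hη

/-- **On a fibre the relative residue form is the residue form of the fibre.** Let `ι : X → T` be
holomorphic with image in the fibre where the equation is `F` (`F_{ι x} = F` for all `x`), `F`
homogeneous of degree `d ≥ m + 2` with non-vanishing gradient on its cone, `ψ ∘ ι` an arbitrary map
into `V(F)` (continuity and holomorphic coordinates follow from those of `ψ` and `ι`), `P` homogeneous of
degree `d − m − 2`. If the `m`-form `η` on `T` agrees at the points `ι x'`, `x'` near `x`, with the
relative residue form for admissible indices `(i, j)` at `ι x`, then near `x` the pull-back `ι^* η` IS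
the residue form `residueForm (ψ ∘ ι) F P = (ψ ∘ ι)^* Res(PΩ/F)` of the fibre.
[cite: VoisinHodgeII2003, §6.1.1 and §6.1.3] -/
theorem pullback_eventuallyEq_residueForm (hψ : Continuous ψ) (hhol : HasHolomorphicCoords E ψ)
    {F : MvPolynomial (Fin (m + 2)) ℂ} {d : ℕ} (hF : F.IsHomogeneous d)
    (hjac : ∀ z : Fin (m + 2) → ℂ, z ≠ 0 → MvPolynomial.eval z F = 0 →
      ∃ j, MvPolynomial.eval z (MvPolynomial.pderiv j F) ≠ 0)
    {P : MvPolynomial (Fin (m + 2)) ℂ} (hP : P.IsHomogeneous (d - (m + 2))) (hd : m + 2 ≤ d)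
    (hιc : Continuous ι) (hιd : MDifferentiable 𝓘(ℂ, EX) 𝓘(ℂ, E) ι)
    (hrange : Set.range (ψ ∘ ι) ⊆ projZeroLocus {F})
    {i j : Fin (m + 2)} {x : X} (hx : ι x ∈ liftDomain ψ i)
    (hj : MvPolynomial.eval (projLift ψ i (ι x)) (MvPolynomial.pderiv j F) ≠ 0)
    {η : MForm 𝓘(ℝ, E) M ℂ m}
    (hη : ∀ᶠ x' in 𝓝 x, η (ι x') =
      (show E [⋀^Fin m]→L[ℝ] ℂ from (residueFormula ψ F P i j (ι x')).restrictScalars ℝ)) :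
    ∀ᶠ x' in 𝓝 x, η.pullback 𝓘(ℝ, EX) ι x' = residueForm (ψ ∘ ι) F P x' := by
  have hψι : Continuous (ψ ∘ ι) := hψ.comp hιc
  have hholι : HasHolomorphicCoords EX (ψ ∘ ι) := fun i' k ↦
    (hhol i' k).comp hιd.mdifferentiableOn fun _ hx' ↦ hx'
  have hx' : x ∈ liftDomain (ψ ∘ ι) i := hx
  have hev := residueForm_eventuallyEq (ψ ∘ ι) hF hψι hrange hjac hholι hP hd hx' hj
  have hopen : ∀ᶠ x' in 𝓝 x, ι x' ∈ liftDomain ψ i :=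
    hιc.continuousAt.preimage_mem_nhds ((isOpen_liftDomain ψ hψ i).mem_nhds hx)
  filter_upwards [hev, hη, hopen] with x' h1 h2 h3
  rw [h1, pullback_residueFormula_apply ψ ι hψ hhol F P j (hιd x') h3 h2]

end Pullback

end Literature.AlgebraicGeometry.HodgeTheory

end
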